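import Summits.RiemannHypothesis.RiemannHypothesis.Theorems.WeilTwoPrimeDeflM78FBase
import Literature.NumberTheory.LFunctions.WeilBlockRowsFast
import HarnessLib

/-!
# Deflated two-prime certificate (weilCertDeflM78F): the Bessel block claim `Hp = C H Cᵀ` (parity 1), rows 110–114, fast check

`WeilCert.checkHpRowT` (linear traversals) instead of the indexed `checkHpRow` decide.  Pure proof file.
-/

noncomputable section

set_option linter.dupNamespace false

namespace Summit.RiemannHypothesis.RiemannHypothesis.Theorems.EvenWinsBeyondArch

open Literature.NumberTheory.LFunctions

set_option maxHeartbeats 0 in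
/-- Fast kernel check of claim row 110 of `Hp = C H Cᵀ` (parity 1; linear traversals, triangular `C`). [folklore] -/
theorem checkHpRowT1_110_weilCertDeflM78F : weilCertDeflM78FBase.checkHpRowT weilCertDeflM78FHpO 1 110 = true := by
  decide +kernel

/-- Claim row 110 of `Hp = C H Cᵀ` (parity 1), from the fast check. [folklore] -/
theorem checkHpRow1_110_weilCertDeflM78F : weilCertDeflM78FBase.checkHpRow weilCertDeflM78FHpO 1 110 = true :=
  WeilCert.checkHpRow_of_T checkHpRowT1_110_weilCertDeflM78F

set_option maxHeartbeats 0 in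
/-- Fast kernel check of claim row 111 of `Hp = C H Cᵀ` (parity 1; linear traversals, triangular `C`). [folklore] -/
theorem checkHpRowT1_111_weilCertDeflM78F : weilCertDeflM78FBase.checkHpRowT weilCertDeflM78FHpO 1 111 = true := by
  decide +kernel

/-- Claim row 111 of `Hp = C H Cᵀ` (parity 1), from the fast check. [folklore] -/
theorem checkHpRow1_111_weilCertDeflM78F : weilCertDeflM78FBase.checkHpRow weilCertDeflM78FHpO 1 111 = true :=
  WeilCert.checkHpRow_of_T checkHpRowT1_111_weilCertDeflM78F

set_option maxHeartbeats 0 in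
/-- Fast kernel check of claim row 112 of `Hp = C H Cᵀ` (parity 1; linear traversals, triangular `C`). [folklore] -/
theorem checkHpRowT1_112_weilCertDeflM78F : weilCertDeflM78FBase.checkHpRowT weilCertDeflM78FHpO 1 112 = true := by
  decide +kernel

/-- Claim row 112 of `Hp = C H Cᵀ` (parity 1), from the fast check. [folklore] -/
theorem checkHpRow1_112_weilCertDeflM78F : weilCertDeflM78FBase.checkHpRow weilCertDeflM78FHpO 1 112 = true :=
  WeilCert.checkHpRow_of_T checkHpRowT1_112_weilCertDeflM78F

set_option maxHeartbeats 0 in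
/-- Fast kernel check of claim row 113 of `Hp = C H Cᵀ` (parity 1; linear traversals, triangular `C`). [folklore] -/
theorem checkHpRowT1_113_weilCertDeflM78F : weilCertDeflM78FBase.checkHpRowT weilCertDeflM78FHpO 1 113 = true := by
  decide +kernel

/-- Claim row 113 of `Hp = C H Cᵀ` (parity 1), from the fast check. [folklore] -/
theorem checkHpRow1_113_weilCertDeflM78F : weilCertDeflM78FBase.checkHpRow weilCertDeflM78FHpO 1 113 = true :=
  WeilCert.checkHpRow_of_T checkHpRowT1_113_weilCertDeflM78F

set_option maxHeartbeats 0 in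
/-- Fast kernel check of claim row 114 of `Hp = C H Cᵀ` (parity 1; linear traversals, triangular `C`). [folklore] -/
theorem checkHpRowT1_114_weilCertDeflM78F : weilCertDeflM78FBase.checkHpRowT weilCertDeflM78FHpO 1 114 = true := by
  decide +kernel

/-- Claim row 114 of `Hp = C H Cᵀ` (parity 1), from the fast check. [folklore] -/
theorem checkHpRow1_114_weilCertDeflM78F : weilCertDeflM78FBase.checkHpRow weilCertDeflM78FHpO 1 114 = true :=
  WeilCert.checkHpRow_of_T checkHpRowT1_114_weilCertDeflM78F

end Summit.RiemannHypothesis.RiemannHypothesis.Theorems.EvenWinsBeyondArch
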